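import Summits.Ventures.HSemireg.WedgeHankelRecurrenceHurwitzTotallyPositive

/-!
# Venture HSemireg — DEFINITION 4 IN THE TREE'S CLASS LANGUAGE (`Literature.LinearAlgebra.Matrix.IsTP ∕ IsTPk ∕ IsTNk`, Fallat–Johnson §0.0): **the `m × (m+1)` Hankel block of a point of the
# domain of stability is a TP matrix (all minors positive) and conversely; every finite section `(s_{i+k})_{i<p, k<q}` of a Hankel matrix that is totally positive of rank `m` is `TP_m` and
# `TN` (minors of order `≤ m` positive, larger ones zero); THEOREM 20 (even degree) as «the Hankel block of the Markov parameters is TP»**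

HONEST FRAMING. Part of the Lean index of the computation cell `pub-hsemireg` (seat p10 gen 41, Sunday typer «UNIFORM-IN-n»).
A DICTIONARY between N247 ∕ N248 and the PROVED Literature classes `IsTP`, `IsTPk`, `IsTNk` (`Literature/LinearAlgebra/Matrix/TotallyNonnegative`): no new mathematics, no variety, no cohomology
theory, no sheaf, no Ext group and no semiregularity map; nothing here says that HC / HC_CM / HC_AV holds; no Literature fact (unproved `Prop`) is declared or used.  Custodian versions as in
`WedgeHankelSiegelIdeal` (1/3).
SOURCE (cited): F. R. Gantmacher, *The Theory of Matrices* II, Ch. XV §16 Definition 4, Theorems 19 ∕ 20, §17 (132) (chunks p0202–p0205, read); S. M. Fallat, C. R. Johnson, *Totally Nonnegative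
Matrices* (2011), §0.0 («`TP_k`: all minors on no more than `k` rows are positive»; typed in Literature `TotallyNonnegative`).
DICTIONARY.  `IsTP A` = all minors of `A` on strictly increasing rows ∕ columns positive; `IsTPk k A` = those of order `≤ k`; `IsTNk k A` = those of order `≤ k` nonnegative; the block (132) is
`Matrix.of fun (i : Fin (t+1)) (k : Fin (t+2)) => s (i + k)`, a general section is `Matrix.of fun (i : Fin p) (k : Fin q) => s (i + k)`.
DEDUP DISCLOSURE (`rg -n 'IsTP|IsTPk' Summits/Ventures/HSemireg`, 2026-09-02): no HSemireg file uses the Literature classes; N247 ∕ N248 state the minors explicitly.  The 5 names below: 0 hits.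

WHAT IS IN THE TREE.  Literature `Literature.LinearAlgebra.Matrix.IsTP ∕ IsTPk ∕ IsTNk` (`isTP_iff`, `isTPk_iff`, `isTNk_iff`); N247 `forall_det_submatrix_hankelBlock_pos_iff`,
`hankel_totallyPositive_rank_iff`; N248 `forall_re_neg_iff_hankel_markovSeq_totallyPositive_of_even`.
THIS FILE (namespace `Summit.Ventures.HSemireg.Wedge.HankelOuter` continued; CHAINED on N248; 0 definitions):
* §1016 **`isTP_hankelBlock_iff`** (block (132) `IsTP ⟺ H_t(s) ≻ 0 ∧ H_t(s ∘ succ) ≻ 0`), `isTPk_hankelSection_of_totallyPositive` ∕ `isTNk_hankelSection_of_totallyPositive` (Def 4 ⇒ every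
  `p × q` section is `TP_{t+1}` and `TN_k` for all `k`), **`isTP_hankelBlock_markovSeq_iff_of_even`** (Theorem 20, even degree: Hurwitz ⟺ the block of the Markov parameters is TP),
  `isTP_hankelBlock_markovSeq_iff_of_odd` (odd degree, with `s_{−1} > 0`).
CAVEATS.  Nothing Ext-side.  New names only.
-/

open Module Polynomial
open scoped Matrix Polynomial

namespace Summit.Ventures.HSemireg.Wedge.HankelOuter

open Literature.LinearAlgebra.Matrix (IsTP IsTPk IsTNk)

/-! ## §1016. Definition 4 and Theorems 19 ∕ 20 ∕ (132) in the class language `IsTP ∕ IsTPk ∕ IsTNk` -/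

/-- **The block (132) is TP iff the point lies in the domain of stability**: `IsTP (s_{i+k})_{i ≤ t, k ≤ t+1} ⟺ H_t(s) ≻ 0 ∧ H_t(s ∘ succ) ≻ 0`.
[Gantmacher XV §17 (132) with (115); Fallat–Johnson §0.0 `TP`; N247; this file, §1016] -/
theorem isTP_hankelBlock_iff (t : ℕ) (s : ℕ → ℝ) :
    IsTP (Matrix.of fun (i : Fin (t + 1)) (k : Fin (t + 2)) => s ((i : ℕ) + (k : ℕ))) ↔ (hankelSq ℝ t s).PosDef ∧ (hankelSq ℝ t (fun p => s (p + 1))).PosDef :=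
  forall_det_submatrix_hankelBlock_pos_iff t s

/-- **Definition 4 ⇒ every finite section is `TP_m`**: if the Hankel matrix of `s` is totally positive of rank `t + 1` (minors of order `≤ t + 1` on increasing rows ∕ columns positive) then every
section `(s_{i+k})_{i<p, k<q}` is `TP_{t+1}`. [Gantmacher XV §16 Def 4; Fallat–Johnson §0.0 `TP_k`; this file, §1016] -/
theorem isTPk_hankelSection_of_totallyPositive {t : ℕ} {s : ℕ → ℝ}
    (hpos : ∀ h, h ≤ t + 1 → ∀ r c : Fin h → ℕ, StrictMono r → StrictMono c → 0 < (Matrix.of fun a b : Fin h => s (r a + c b)).det) (p q : ℕ) :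
    IsTPk (t + 1) (Matrix.of fun (i : Fin p) (k : Fin q) => s ((i : ℕ) + (k : ℕ))) := by
  intro j hj r c hr hc
  have hmat : (Matrix.of fun (i : Fin p) (k : Fin q) => s ((i : ℕ) + (k : ℕ))).submatrix r c = Matrix.of fun a b : Fin j => s ((fun a => (r a : ℕ)) a + (fun b => (c b : ℕ)) b) := by
    ext a b
    simp only [Matrix.submatrix_apply, Matrix.of_apply]
  rw [hmat]
  exact hpos j hj _ _ (fun a b hab => hr hab) (fun a b hab => hc hab)

/-- **Definition 4 ⇒ every finite section is `TN_k` for every `k`** (minors of order `≤ t + 1` positive, of order `> t + 1` zero). [Gantmacher XV §16 Def 4; Fallat–Johnson §0.0 `TN_k`; this file, §1016] -/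
theorem isTNk_hankelSection_of_totallyPositive {t : ℕ} {s : ℕ → ℝ}
    (hpos : ∀ h, h ≤ t + 1 → ∀ r c : Fin h → ℕ, StrictMono r → StrictMono c → 0 < (Matrix.of fun a b : Fin h => s (r a + c b)).det)
    (hzero : ∀ h, t + 1 < h → ∀ r c : Fin h → ℕ, (Matrix.of fun a b : Fin h => s (r a + c b)).det = 0) (p q k : ℕ) :
    IsTNk k (Matrix.of fun (i : Fin p) (k : Fin q) => s ((i : ℕ) + (k : ℕ))) := by
  intro j _ r c hr hc
  have hmat : (Matrix.of fun (i : Fin p) (k : Fin q) => s ((i : ℕ) + (k : ℕ))).submatrix r c = Matrix.of fun a b : Fin j => s ((fun a => (r a : ℕ)) a + (fun b => (c b : ℕ)) b) := by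
    ext a b
    simp only [Matrix.submatrix_apply, Matrix.of_apply]
  rw [hmat]
  rcases le_or_gt j (t + 1) with hj | hj
  · exact (hpos j hj _ _ (fun a b hab => hr hab) (fun a b hab => hc hab)).le
  · exact (hzero j hj _ _).ge

/-- **THEOREM 20 (even degree `2t + 2`) in class language: `h(X²) + X·g(X²)` is Hurwitz iff the `(t+1) × (t+2)` Hankel block of its Markov parameters is a TP matrix.**
[Gantmacher XV §16 Thm 20 ∕ §17 (132); Fallat–Johnson `TP`; N232 (Thm 17) + N247; this file, §1016] -/
theorem isTP_hankelBlock_markovSeq_iff_of_even (t : ℕ) {h g : ℝ[X]} (hh : h.natDegree = t + 1) (hg : g.natDegree ≤ t) :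
    IsTP (Matrix.of fun (i : Fin (t + 1)) (k : Fin (t + 2)) => markovSeq ℝ h g ((i : ℕ) + (k : ℕ)))
      ↔ ∀ z ∈ ((expand ℝ 2 h + Polynomial.X * expand ℝ 2 g).map (algebraMap ℝ ℂ)).roots, z.re < 0 := by
  rw [isTP_hankelBlock_iff, forall_re_neg_iff_posDef_hankelSq_markovSeq_of_even t hh hg]

/-- **THEOREM 20 (odd degree `2t + 3`) in class language**: Hurwitz iff the Hankel block of the Markov parameters is TP and `s_{−1} = lc g ∕ lc h > 0`.
[Gantmacher XV §16 Thm 20 (odd `n`); N232 (Thm 17 odd) + N247; this file, §1016] -/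
theorem isTP_hankelBlock_markovSeq_iff_of_odd (t : ℕ) {h g : ℝ[X]} (hg : g.natDegree = t + 1) (hh : h.natDegree = t + 1) :
    (IsTP (Matrix.of fun (i : Fin (t + 1)) (k : Fin (t + 2)) => markovSeq ℝ h g ((i : ℕ) + (k : ℕ))) ∧ 0 < g.leadingCoeff / h.leadingCoeff)
      ↔ ∀ z ∈ ((expand ℝ 2 h + Polynomial.X * expand ℝ 2 g).map (algebraMap ℝ ℂ)).roots, z.re < 0 := by
  rw [isTP_hankelBlock_iff, forall_re_neg_iff_posDef_hankelSq_markovSeq_of_odd t hg hh, and_assoc]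

end Summit.Ventures.HSemireg.Wedge.HankelOuter
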